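import Literature.Probability.LatticeModels.TriMeshLattice
import Literature.Probability.LatticeModels.MeshColumns
import HarnessLib

/-!
# Triangles of a column of the sheared triangular mesh: crossing edges, side functionals, centres

Topic: Probability / LatticeModels (triangular twin `TriMesh*` of the series `MeshColumns` …
`MeshDomainJordan`, "the largest mesh component of a Jordan domain is the bulk", for H21's
discretisation by `δ𝕋`; sub-namespace `Literature.Probability.LatticeModels.TriMesh`). This file
sits on top of `TriMeshLattice.lean` (the shear `triLinear : a + ib ↦ a + bζ`, the dictionary
`triMeshPoint δ x = triLinear (meshPoint δ x)`, the sheared Jordan domain `triPreimage`, the two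
kinds of rungs `rung`/`drung` of a column and the crossing parity of `𝕋`-walks) and supplies the
geometry that replaces the *cells* of the `ℤ²` series: on the sheared triangular lattice a column
`δk < re < δ(k+1)` is cut by its rungs **and** its antidiagonals into **triangles**, and it is
runs of perfect *triangles* (not cells) that the parity argument must use — the centre of a mesh
cell lies on its antidiagonal, which may be a mesh edge.

* `triLines δ` — the three families of lattice lines `re ∈ δℤ`, `im ∈ δℤ`, `re + im ∈ δℤ`;
  closed `𝕋`-edges lie on them.
* **Crossing edges of column `k`**, indexed uniformly by `n : ℤ`:
  `kcross k n = {(k, ⌈n/2⌉), (k+1, ⌊n/2⌋)}` — for even `n = 2j` the rung `rung k j`, for odd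
  `n = 2j + 1` the antidiagonal `drung k j` (`kcross_two_mul`, `kcross_two_mul_add_one`,
  `isKCross_iff_isKTriRung`); it meets the midline `re = δ(k + ½)` at height `δ n / 2`, its
  midpoint.
* **Triangles** `ktri δ k n` — the open triangle of column `k` between the crossing edges `n` and
  `n + 1`, cut out by the affine functionals `sideFn δ k n`; its corners (`IsCorner`) are the
  ends of the two edges; its *centre* `kcenter δ k n = (δ(k + ½), δ(n/2 + ¼))` lies on the
  midline. Triangles are open, convex, miss the lattice lines, contain their centre; points
  satisfying the weak inequalities lie in the closure (`mem_closure_ktri`), in particular the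
  corners, and distinct corners are `𝕋`-neighbours.
* Bridges to the tree graphs: `mem_triMeshVertices_iff_shear`, `triMeshGraph_adj_iff_shear`.

Folklore lattice geometry. Mathlib anchors: `segment`, `Convex`, `mem_closure_of_tendsto`,
`Int.emod_two_eq_zero_or_one`. H21 anchors: `triLinear`, `latTriMeshGraph`, `Mesh.rung`,
`Mesh.drung`, `Mesh.IsKTriRung`, `Mesh.site2_ext'` (`TriMeshLattice.lean`), `Mesh.corner`,
`Mesh.ne_mul_int_of_mem_Ioo` (`MeshColumns.lean`), `meshPoint`, `triMeshGraph`.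
-/

namespace Literature.Probability.LatticeModels.TriMesh

open Set Complex Metric

noncomputable section

/-! ### Bridges to the tree graphs -/

/-- Mesh vertices of `Ω` on `δ𝕋` are the sites whose square mesh point lies in the sheared domain
`Ω' = triLinear ⁻¹' Ω` (restatement of `mem_triMeshVertices_iff_lat`). [folklore] -/
theorem mem_triMeshVertices_iff_shear {Ω : Set ℂ} {δ : ℝ} {x : Site 2} :
    x ∈ triMeshVertices Ω δ ↔ meshPoint δ x ∈ triLinear ⁻¹' Ω :=
  mem_triMeshVertices_iff_lat

/-- Adjacency in the triangular mesh graph of `Ω` is `𝕋`-adjacency plus "the closed square-mesh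
edge lies in the closure of the sheared domain" (`triMeshGraph_adj_iff_lat` unfolded). [folklore] -/
theorem triMeshGraph_adj_iff_shear {Ω : Set ℂ} {δ : ℝ} {x y : Site 2} :
    (triMeshGraph Ω δ).Adj x y ↔
      triGraph.Adj x y ∧ segment ℝ (meshPoint δ x) (meshPoint δ y) ⊆ closure (triLinear ⁻¹' Ω) :=
  triMeshGraph_adj_iff_lat.trans latTriMeshGraph_adj_iff

/-- The frontier of the sheared domain is the sheared frontier. [folklore] -/
theorem frontier_preimage_triLinear (Ω : Set ℂ) :
    frontier (triLinear ⁻¹' Ω) = triLinear ⁻¹' frontier Ω :=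
  (triLinear_preimage_frontier Ω).symm

/-! ### Lattice lines -/

/-- The lattice lines of `𝕋` at mesh `δ` in lattice coordinates: `re ∈ δℤ`, `im ∈ δℤ` or
`re + im ∈ δℤ`. [folklore] -/
def triLines (δ : ℝ) : Set ℂ :=
  {z | (∃ n : ℤ, z.re = δ * n) ∨ (∃ n : ℤ, z.im = δ * n) ∨ ∃ n : ℤ, z.re + z.im = δ * n}

/-- Mesh points lie on the lattice lines. [folklore] -/
theorem meshPoint_mem_triLines (δ : ℝ) (x : Site 2) : meshPoint δ x ∈ triLines δ :=
  Or.inl ⟨x 0, meshPoint_re δ x⟩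

/-- A closed `𝕋`-edge lies on the lattice lines. [folklore] -/
theorem segment_meshPoint_subset_triLines (δ : ℝ) {x y : Site 2} (h : triGraph.Adj x y) :
    segment ℝ (meshPoint δ x) (meshPoint δ y) ⊆ triLines δ := by
  intro z hz
  obtain ⟨a, b, -, -, hab, rfl⟩ := hz
  rcases triGraph_adj_apply h with ⟨-, h1⟩ | ⟨h0, -⟩ | ⟨-, h1⟩ | ⟨h0, -⟩ | ⟨h0, h1⟩ | ⟨h0, h1⟩
  · right; left
    refine ⟨x 1, ?_⟩
    simp only [add_im, smul_im, meshPoint_im, h1, smul_eq_mul]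
    rw [← add_mul, hab, one_mul]
  · left
    refine ⟨x 0, ?_⟩
    simp only [add_re, smul_re, meshPoint_re, h0, smul_eq_mul]
    rw [← add_mul, hab, one_mul]
  · right; left
    refine ⟨x 1, ?_⟩
    simp only [add_im, smul_im, meshPoint_im, ← h1, smul_eq_mul]
    rw [← add_mul, hab, one_mul]
  · left
    refine ⟨x 0, ?_⟩
    simp only [add_re, smul_re, meshPoint_re, ← h0, smul_eq_mul]
    rw [← add_mul, hab, one_mul]
  · right; right
    refine ⟨x 0 + x 1, ?_⟩
    simp only [add_re, smul_re, meshPoint_re, add_im, smul_im, meshPoint_im, h0, h1, smul_eq_mul]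
    push_cast
    linear_combination δ * ((x 0 : ℝ) + x 1) * hab
  · right; right
    refine ⟨x 0 + x 1, ?_⟩
    have h0' : (y 0 : ℝ) = x 0 - 1 := by
      have : (x 0 : ℝ) = y 0 + 1 := by exact_mod_cast h0
      linarith
    have h1' : (y 1 : ℝ) = x 1 + 1 := by
      have : (x 1 : ℝ) = y 1 - 1 := by exact_mod_cast h1
      linarith
    simp only [add_re, smul_re, meshPoint_re, add_im, smul_im, meshPoint_im, h0', h1', smul_eq_mul]
    push_cast
    linear_combination δ * ((x 0 : ℝ) + x 1) * hab

/-! ### Crossing edges of a column -/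

/-- `⌈n/2⌉`: the second coordinate of the left end of the crossing edge `n`. [folklore] -/
def cTop (n : ℤ) : ℤ := n / 2 + n % 2

/-- `⌊n/2⌋`: the second coordinate of the right end of the crossing edge `n`. [folklore] -/
def cBot (n : ℤ) : ℤ := n / 2

/-- `n % 2 ∈ {0, 1}`. [folklore] -/
theorem emod_two_eq (n : ℤ) : n % 2 = 0 ∨ n % 2 = 1 := Int.emod_two_eq_zero_or_one n

/-- `2 ⌊n/2⌋ + n % 2 = n`. [folklore] -/
theorem two_mul_cBot_add (n : ℤ) : 2 * cBot n + n % 2 = n := by unfold cBot; omega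

/-- `⌈n/2⌉ = ⌊n/2⌋ + n % 2`. [folklore] -/
theorem cTop_eq (n : ℤ) : cTop n = cBot n + n % 2 := rfl

/-- `⌈(n+1)/2⌉ = ⌊n/2⌋ + 1`. [folklore] -/
theorem cTop_succ (n : ℤ) : cTop (n + 1) = cBot n + 1 := by unfold cTop cBot; omega

/-- `⌊(n+1)/2⌋ = ⌈n/2⌉`. [folklore] -/
theorem cBot_succ (n : ℤ) : cBot (n + 1) = cTop n := by unfold cTop cBot; omega

/-- `(n + 1) % 2 = 1 - n % 2`. [folklore] -/
theorem emod_two_succ (n : ℤ) : (n + 1) % 2 = 1 - n % 2 := by omega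

/-- Real-cast bookkeeping: `2 ⌊n/2⌋ + (n % 2) = n` in `ℝ`. [folklore] -/
theorem two_mul_cBot_add_real (n : ℤ) : 2 * (cBot n : ℝ) + ((n % 2 : ℤ) : ℝ) = n := by
  exact_mod_cast two_mul_cBot_add n

/-- Real-cast bookkeeping: `0 ≤ n % 2 ≤ 1` in `ℝ`. [folklore] -/
theorem emod_two_real_mem (n : ℤ) : (0 : ℝ) ≤ ((n % 2 : ℤ) : ℝ) ∧ ((n % 2 : ℤ) : ℝ) ≤ 1 := by
  rcases emod_two_eq n with h | h <;> simp [h]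

/-- The left end `(k, ⌈n/2⌉)` of the crossing edge `n` of column `k`. [folklore] -/
def xL (k n : ℤ) : Site 2 := ![k, cTop n]

/-- The right end `(k + 1, ⌊n/2⌋)` of the crossing edge `n` of column `k`. [folklore] -/
def xR (k n : ℤ) : Site 2 := ![k + 1, cBot n]

/-- Coordinates of the ends. [folklore] -/
@[simp] theorem xL_zero (k n : ℤ) : xL k n 0 = k := rfl

/-- Coordinates of the ends. [folklore] -/
@[simp] theorem xL_one (k n : ℤ) : xL k n 1 = cTop n := rfl

/-- Coordinates of the ends. [folklore] -/
@[simp] theorem xR_zero (k n : ℤ) : xR k n 0 = k + 1 := rfl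

/-- Coordinates of the ends. [folklore] -/
@[simp] theorem xR_one (k n : ℤ) : xR k n 1 = cBot n := rfl

/-- Consecutive edges share ends: the left end of edge `n + 1` is one above that of edge `n`
when `n` is even, and equal to it when `n` is odd; dually on the right. [folklore] -/
theorem xL_succ_one (k n : ℤ) : xL k (n + 1) 1 = cBot n + 1 := by simp [cTop_succ]

/-- See `xL_succ_one`. [folklore] -/
theorem xR_succ_one (k n : ℤ) : xR k (n + 1) 1 = cTop n := by simp [cBot_succ]

/-- The two ends of a crossing edge are `𝕋`-neighbours (a rung for even `n`, an antidiagonal for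
odd `n`). [folklore] -/
theorem triGraph_adj_xL_xR (k n : ℤ) : triGraph.Adj (xL k n) (xR k n) := by
  rw [triGraph_adj_iff]
  rcases emod_two_eq n with h | h
  · left
    rw [zdGraph_adj_iff]
    refine ⟨0, Or.inl ?_⟩
    funext l; fin_cases l
    · simp [xL, xR]
    · simp [xL, xR, cTop_eq, h]
  · right; left
    funext l; fin_cases l
    · simp [xL, xR, triDiag]
    · simp [xL, xR, triDiag, cTop_eq, h]

/-- The crossing edge `n` of column `k`: `{(k, ⌈n/2⌉), (k+1, ⌊n/2⌋)}`. [folklore] -/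
def kcross (k n : ℤ) : Sym2 (Site 2) := s(xL k n, xR k n)

/-- `e` is a crossing edge of column `k`. [folklore] -/
def IsKCross (k : ℤ) (e : Sym2 (Site 2)) : Prop := ∃ n, e = kcross k n

/-- Even crossing edges are the horizontal rungs of the `ℤ²` series: `kcross k (2j) = rung k j`.
[folklore] -/
theorem kcross_two_mul (k j : ℤ) : kcross k (2 * j) = Mesh.rung k j := by
  rw [kcross, Mesh.rung]
  congr 1
  · exact Mesh.site2_ext' (by simp [Mesh.corner]) (by simp only [xL_one, cTop, Mesh.corner_one]; simp)
  · exact Mesh.site2_ext' (by simp [Mesh.corner]) (by simp [Mesh.corner, cBot])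

/-- Odd crossing edges are the antidiagonal rungs: `kcross k (2j + 1) = drung k j`. [folklore] -/
theorem kcross_two_mul_add_one (k j : ℤ) : kcross k (2 * j + 1) = Mesh.drung k j := by
  rw [kcross, Mesh.drung]
  congr 1
  · exact Mesh.site2_ext' (by simp [Mesh.corner]) (by simp [Mesh.corner, cTop]; omega)
  · exact Mesh.site2_ext' (by simp [Mesh.corner]) (by simp [Mesh.corner, cBot]; omega)

/-- Every crossing edge is `kcross k (2 ⌊n/2⌋ + n % 2)`. [folklore] -/
theorem kcross_eq_of_emod (k n : ℤ) :
    (n % 2 = 0 → kcross k n = Mesh.rung k (n / 2)) ∧ (n % 2 = 1 → kcross k n = Mesh.drung k (n / 2)) := by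
  constructor
  · intro h
    rw [← kcross_two_mul]; congr 1; omega
  · intro h
    rw [← kcross_two_mul_add_one]; congr 1; omega

/-- **The crossing edges of column `k` are exactly the rungs of both kinds** of
`TriMeshLattice.lean`. [folklore] -/
theorem isKCross_iff_isKTriRung (k : ℤ) (e : Sym2 (Site 2)) : IsKCross k e ↔ Mesh.IsKTriRung k e := by
  constructor
  · rintro ⟨n, rfl⟩
    rcases emod_two_eq n with h | h
    · exact Or.inl ⟨n / 2, (kcross_eq_of_emod k n).1 h⟩
    · exact Or.inr ⟨n / 2, (kcross_eq_of_emod k n).2 h⟩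
  · rintro (⟨j, rfl⟩ | ⟨j, rfl⟩)
    · exact ⟨2 * j, (kcross_two_mul k j).symm⟩
    · exact ⟨2 * j + 1, (kcross_two_mul_add_one k j).symm⟩

/-! ### Triangles of a column -/

/-- The affine functional of the line carrying the crossing edge `n` of column `k`, positive
strictly above it: `im z - δ⌈n/2⌉ + (n % 2)(re z - δk)` (for even `n` the height above the rung,
for odd `n` the signed distance `re + im - δ(k + ⌈n/2⌉)` to the antidiagonal). [folklore] -/
def sideFn (δ : ℝ) (k n : ℤ) (z : ℂ) : ℝ :=
  z.im - δ * cTop n + ((n % 2 : ℤ) : ℝ) * (z.re - δ * k)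

/-- The open triangle of column `k` between the crossing edges `n` and `n + 1`: for `n = 2j` the
lower-left half `{re > δk, im > δj, re + im < δ(k + j + 1)}` of the cell `(k, j)`, for
`n = 2j + 1` its upper-right half. [folklore] -/
def ktri (δ : ℝ) (k n : ℤ) : Set ℂ :=
  {z | δ * k < z.re ∧ z.re < δ * (k + 1) ∧ 0 < sideFn δ k n z ∧ sideFn δ k (n + 1) z < 0}

/-- The *centre* of the triangle `n` of column `k`: the point `(δ(k + ½), δ(n/2 + ¼))` of the
midline. [folklore] -/
def kcenter (δ : ℝ) (k n : ℤ) : ℂ := ⟨δ * (k + 1 / 2), δ * ((n : ℝ) / 2 + 1 / 4)⟩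

/-- Real and imaginary parts of the centre. [folklore] -/
@[simp] theorem kcenter_re (δ : ℝ) (k n : ℤ) : (kcenter δ k n).re = δ * (k + 1 / 2) := rfl

/-- Real and imaginary parts of the centre. [folklore] -/
@[simp] theorem kcenter_im (δ : ℝ) (k n : ℤ) : (kcenter δ k n).im = δ * ((n : ℝ) / 2 + 1 / 4) := rfl

/-- Membership in a triangle, unfolded. [folklore] -/
theorem mem_ktri_iff {δ : ℝ} {k n : ℤ} {z : ℂ} :
    z ∈ ktri δ k n ↔
      δ * k < z.re ∧ z.re < δ * (k + 1) ∧ 0 < sideFn δ k n z ∧ sideFn δ k (n + 1) z < 0 :=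
  Iff.rfl

/-- The side functional is continuous. [folklore] -/
theorem continuous_sideFn (δ : ℝ) (k n : ℤ) : Continuous (sideFn δ k n) := by
  unfold sideFn; fun_prop

/-- Triangles are open. [folklore] -/
theorem isOpen_ktri (δ : ℝ) (k n : ℤ) : IsOpen (ktri δ k n) := by
  have : ktri δ k n = ({z : ℂ | δ * k < z.re} ∩ {z : ℂ | z.re < δ * (k + 1)}) ∩
      ({z : ℂ | 0 < sideFn δ k n z} ∩ {z : ℂ | sideFn δ k (n + 1) z < 0}) := by
    ext z; simp only [mem_inter_iff, mem_setOf_eq, mem_ktri_iff]; tauto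
  rw [this]
  exact ((isOpen_lt continuous_const Complex.continuous_re).inter
    (isOpen_lt Complex.continuous_re continuous_const)).inter
    ((isOpen_lt continuous_const (continuous_sideFn δ k n)).inter
      (isOpen_lt (continuous_sideFn δ k (n + 1)) continuous_const))

/-- The side functional is affine along segments. [folklore] -/
theorem sideFn_add_smul (δ : ℝ) (k n : ℤ) (c p : ℂ) (t : ℝ) :
    sideFn δ k n (c + t • (p - c)) = (1 - t) * sideFn δ k n c + t * sideFn δ k n p := by
  unfold sideFn
  simp only [add_re, add_im, smul_re, smul_im, sub_re, sub_im, smul_eq_mul]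
  ring

/-- The side functional of a convex combination. [folklore] -/
theorem sideFn_convexComb (δ : ℝ) (k n : ℤ) (z w : ℂ) {a b : ℝ} (hab : a + b = 1) :
    sideFn δ k n (a • z + b • w) = a * sideFn δ k n z + b * sideFn δ k n w := by
  unfold sideFn
  simp only [add_re, add_im, smul_re, smul_im, smul_eq_mul]
  have hb : b = 1 - a := by linarith
  subst hb
  ring

/-- Triangles are convex. [folklore] -/
theorem convex_ktri (δ : ℝ) (k n : ℤ) : Convex ℝ (ktri δ k n) := by
  intro z hz w hw a b ha hb hab
  obtain ⟨hz1, hz2, hz3, hz4⟩ := hz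
  obtain ⟨hw1, hw2, hw3, hw4⟩ := hw
  refine ⟨?_, ?_, ?_, ?_⟩
  · simp only [add_re, smul_re, smul_eq_mul]
    have : δ * k = a * (δ * k) + b * (δ * k) := by rw [← add_mul, hab, one_mul]
    rw [this]
    rcases ha.eq_or_lt with rfl | ha'
    · simp only [zero_add] at hab; subst hab; simpa using hw1
    · nlinarith
  · simp only [add_re, smul_re, smul_eq_mul]
    have : δ * (k + 1) = a * (δ * (k + 1)) + b * (δ * (k + 1)) := by rw [← add_mul, hab, one_mul]
    rw [this]
    rcases ha.eq_or_lt with rfl | ha'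
    · simp only [zero_add] at hab; subst hab; simpa using hw2
    · nlinarith
  · rw [sideFn_convexComb δ k n z w hab]
    rcases ha.eq_or_lt with rfl | ha'
    · simp only [zero_add] at hab; subst hab; simpa using hw3
    · nlinarith
  · rw [sideFn_convexComb δ k (n + 1) z w hab]
    rcases ha.eq_or_lt with rfl | ha'
    · simp only [zero_add] at hab; subst hab; simpa using hw4
    · nlinarith

/-- The side functional at the centre of its own triangle: `+δ/4` for the lower edge. [folklore] -/
theorem sideFn_kcenter (δ : ℝ) (k n : ℤ) : sideFn δ k n (kcenter δ k n) = δ / 4 := by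
  have h := two_mul_cBot_add_real n
  unfold sideFn
  rw [kcenter_re, kcenter_im, cTop_eq]
  push_cast
  linear_combination (-(δ / 2)) * h

/-- The side functional at the centre of its own triangle: `-δ/4` for the upper edge. [folklore] -/
theorem sideFn_succ_kcenter (δ : ℝ) (k n : ℤ) : sideFn δ k (n + 1) (kcenter δ k n) = -(δ / 4) := by
  have h := two_mul_cBot_add_real n
  have h' : (((n + 1) % 2 : ℤ) : ℝ) = 1 - ((n % 2 : ℤ) : ℝ) := by exact_mod_cast emod_two_succ n
  unfold sideFn
  rw [kcenter_re, kcenter_im, cTop_succ, h']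
  push_cast
  linear_combination (-(δ / 2)) * h

/-- **The centre lies in its triangle** (`δ > 0`). [folklore] -/
theorem kcenter_mem_ktri {δ : ℝ} (hδ : 0 < δ) (k n : ℤ) : kcenter δ k n ∈ ktri δ k n := by
  refine ⟨?_, ?_, ?_, ?_⟩
  · rw [kcenter_re]; nlinarith
  · rw [kcenter_re]; nlinarith
  · rw [sideFn_kcenter]; positivity
  · rw [sideFn_succ_kcenter]; linarith

/-- **Coordinate bounds inside a triangle.** A point of the triangle `n` of column `k` has
`re ∈ (δk, δ(k+1))`, `im ∈ (δ⌊n/2⌋, δ(⌊n/2⌋ + 1))` and `re + im ∈ (δ(k + ⌈n/2⌉), δ(k + ⌈n/2⌉ + 1))`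
(`δ > 0`). [folklore] -/
theorem coord_bounds_of_mem_ktri {δ : ℝ} {k n : ℤ} {z : ℂ} (hz : z ∈ ktri δ k n) :
    (δ * k < z.re ∧ z.re < δ * (k + 1)) ∧
      (δ * cBot n < z.im ∧ z.im < δ * (cBot n + 1)) ∧
      (δ * (k + cTop n) < z.re + z.im ∧ z.re + z.im < δ * (k + cTop n + 1)) := by
  obtain ⟨h1, h2, h3, h4⟩ := hz
  unfold sideFn at h3 h4
  rw [cTop_succ] at h4
  have h' : (((n + 1) % 2 : ℤ) : ℝ) = 1 - ((n % 2 : ℤ) : ℝ) := by exact_mod_cast emod_two_succ n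
  rw [h'] at h4
  rw [cTop_eq] at h3 ⊢
  push_cast at h3 h4 ⊢
  rcases emod_two_eq n with h | h
  · have h0 : ((n % 2 : ℤ) : ℝ) = 0 := by exact_mod_cast h
    rw [h0] at h3 h4 ⊢
    refine ⟨⟨h1, h2⟩, ⟨by linarith, by linarith⟩, by linarith, by linarith⟩
  · have h0 : ((n % 2 : ℤ) : ℝ) = 1 := by exact_mod_cast h
    rw [h0] at h3 h4 ⊢
    refine ⟨⟨h1, h2⟩, ⟨by linarith, by linarith⟩, by linarith, by linarith⟩

/-- Triangles miss the lattice lines (`δ > 0`). [folklore] -/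
theorem ktri_subset_compl_triLines {δ : ℝ} (hδ : 0 < δ) (k n : ℤ) :
    ktri δ k n ⊆ (triLines δ)ᶜ := by
  intro z hz hl
  obtain ⟨hre, him, hsum⟩ := coord_bounds_of_mem_ktri hz
  rcases hl with ⟨m, hm⟩ | ⟨m, hm⟩ | ⟨m, hm⟩
  · exact Mesh.ne_mul_int_of_mem_Ioo hδ hre m hm
  · exact Mesh.ne_mul_int_of_mem_Ioo hδ him m hm
  · exact Mesh.ne_mul_int_of_mem_Ioo hδ (n := k + cTop n) (by push_cast; exact hsum) m hm

/-- Mesh points are not in (open) triangles. [folklore] -/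
theorem meshPoint_not_mem_ktri {δ : ℝ} (hδ : 0 < δ) (x : Site 2) (k n : ℤ) :
    meshPoint δ x ∉ ktri δ k n := fun h =>
  ktri_subset_compl_triLines hδ k n h (meshPoint_mem_triLines δ x)

/-- Two points of one triangle are at distance `< 2δ`. [folklore] -/
theorem dist_lt_of_mem_ktri {δ : ℝ} {k n : ℤ} {z w : ℂ} (hz : z ∈ ktri δ k n)
    (hw : w ∈ ktri δ k n) : dist z w < 2 * δ := by
  obtain ⟨⟨h1, h2⟩, ⟨h3, h4⟩, -⟩ := coord_bounds_of_mem_ktri hz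
  obtain ⟨⟨h5, h6⟩, ⟨h7, h8⟩, -⟩ := coord_bounds_of_mem_ktri hw
  rw [Complex.dist_eq]
  refine (norm_le_abs_re_add_abs_im _).trans_lt ?_
  rw [sub_re, sub_im]
  have hre : |z.re - w.re| < δ := by rw [abs_lt]; constructor <;> linarith
  have him : |z.im - w.im| < δ := by rw [abs_lt]; constructor <;> linarith
  linarith

/-- Points of a triangle are within `δ` of its centre horizontally and `2δ` in all. [folklore] -/
theorem dist_kcenter_lt_of_mem_ktri {δ : ℝ} (hδ : 0 < δ) {k n : ℤ} {z : ℂ} (hz : z ∈ ktri δ k n) :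
    dist z (kcenter δ k n) < 2 * δ :=
  dist_lt_of_mem_ktri hz (kcenter_mem_ktri hδ k n)

/-! ### The closure of a triangle and its corners -/

/-- **Weak inequalities give the closure.** A point satisfying the four defining inequalities of
the triangle weakly lies in its closure: the points of the segment from the centre to it, short of
the end, satisfy them strictly. [folklore] -/
theorem mem_closure_ktri {δ : ℝ} (hδ : 0 < δ) {k n : ℤ} {p : ℂ} (h1 : δ * k ≤ p.re)
    (h2 : p.re ≤ δ * (k + 1)) (h3 : 0 ≤ sideFn δ k n p) (h4 : sideFn δ k (n + 1) p ≤ 0) :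
    p ∈ closure (ktri δ k n) := by
  set c := kcenter δ k n with hc
  obtain ⟨hc1, hc2, hc3, hc4⟩ := kcenter_mem_ktri hδ k n
  set f : ℝ → ℂ := fun t => c + t • (p - c) with hf
  have hcont : Continuous f := by rw [hf]; fun_prop
  have hlim : Filter.Tendsto f (nhdsWithin 1 (Iio 1)) (nhds p) := by
    have : f 1 = p := by simp [hf]
    rw [← this]
    exact (hcont.tendsto 1).mono_left nhdsWithin_le_nhds
  refine mem_closure_of_tendsto hlim ?_
  filter_upwards [Ioo_mem_nhdsLT (zero_lt_one' ℝ)] with t ht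
  obtain ⟨ht0, ht1⟩ := ht
  have ht1' : 0 < 1 - t := by linarith
  refine ⟨?_, ?_, ?_, ?_⟩
  · simp only [hf, add_re, smul_re, sub_re, smul_eq_mul]
    nlinarith
  · simp only [hf, add_re, smul_re, sub_re, smul_eq_mul]
    nlinarith
  · rw [sideFn_add_smul]; nlinarith
  · rw [sideFn_add_smul]; nlinarith

/-- The side functional at a mesh point, in integer coordinates. [folklore] -/
theorem sideFn_meshPoint (δ : ℝ) (k n : ℤ) (v : Site 2) :
    sideFn δ k n (meshPoint δ v) = δ * ((v 1 : ℝ) - cTop n + ((n % 2 : ℤ) : ℝ) * ((v 0 : ℝ) - k)) := by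
  unfold sideFn; rw [meshPoint_re, meshPoint_im]; ring

/-- The lower edge functional vanishes at its left end. [folklore] -/
theorem sideFn_xL (δ : ℝ) (k n : ℤ) : sideFn δ k n (meshPoint δ (xL k n)) = 0 := by
  rw [sideFn_meshPoint]; simp

/-- The lower edge functional vanishes at its right end. [folklore] -/
theorem sideFn_xR (δ : ℝ) (k n : ℤ) : sideFn δ k n (meshPoint δ (xR k n)) = 0 := by
  rw [sideFn_meshPoint, xR_zero, xR_one, cTop_eq]; push_cast; ring

/-- The lower edge functional at the ends of the upper edge: `δ(1 - n % 2) ≥ 0` on the left.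
[folklore] -/
theorem sideFn_xL_succ (δ : ℝ) (k n : ℤ) :
    sideFn δ k n (meshPoint δ (xL k (n + 1))) = δ * (1 - ((n % 2 : ℤ) : ℝ)) := by
  rw [sideFn_meshPoint, xL_zero, xL_one, cTop_succ, cTop_eq]; push_cast; ring

/-- The lower edge functional at the ends of the upper edge: `δ (n % 2) ≥ 0` on the right.
[folklore] -/
theorem sideFn_xR_succ (δ : ℝ) (k n : ℤ) :
    sideFn δ k n (meshPoint δ (xR k (n + 1))) = δ * ((n % 2 : ℤ) : ℝ) := by
  rw [sideFn_meshPoint, xR_zero, xR_one, cBot_succ]; push_cast; ring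

/-- The upper edge functional at the ends of the lower edge: `-δ(1 - n % 2) ≤ 0` on the left.
[folklore] -/
theorem sideFn_succ_xL (δ : ℝ) (k n : ℤ) :
    sideFn δ k (n + 1) (meshPoint δ (xL k n)) = -(δ * (1 - ((n % 2 : ℤ) : ℝ))) := by
  have h' : (((n + 1) % 2 : ℤ) : ℝ) = 1 - ((n % 2 : ℤ) : ℝ) := by exact_mod_cast emod_two_succ n
  rw [sideFn_meshPoint, xL_zero, xL_one, cTop_succ, cTop_eq, h']; push_cast; ring

/-- The upper edge functional at the ends of the lower edge: `-δ (n % 2) ≤ 0` on the right.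
[folklore] -/
theorem sideFn_succ_xR (δ : ℝ) (k n : ℤ) :
    sideFn δ k (n + 1) (meshPoint δ (xR k n)) = -(δ * ((n % 2 : ℤ) : ℝ)) := by
  have h' : (((n + 1) % 2 : ℤ) : ℝ) = 1 - ((n % 2 : ℤ) : ℝ) := by exact_mod_cast emod_two_succ n
  rw [sideFn_meshPoint, xR_zero, xR_one, cTop_succ, h']; push_cast; ring

/-- `v` is a corner of the triangle `n` of column `k`: an end of one of its two crossing edges.
[folklore] -/
def IsCorner (k n : ℤ) (v : Site 2) : Prop :=
  v = xL k n ∨ v = xR k n ∨ v = xL k (n + 1) ∨ v = xR k (n + 1)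

/-- **Corners lie in the closure of their triangle** (`δ > 0`). [folklore] -/
theorem meshPoint_mem_closure_ktri {δ : ℝ} (hδ : 0 < δ) {k n : ℤ} {v : Site 2} (hv : IsCorner k n v) :
    meshPoint δ v ∈ closure (ktri δ k n) := by
  obtain ⟨hr0, hr1⟩ := emod_two_real_mem n
  have hδk : δ * k ≤ δ * (k + 1) := by nlinarith
  rcases hv with rfl | rfl | rfl | rfl
  · refine mem_closure_ktri hδ ?_ ?_ ?_ ?_
    · rw [meshPoint_re, xL_zero]
    · rw [meshPoint_re, xL_zero]; exact hδk
    · rw [sideFn_xL]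
    · rw [sideFn_succ_xL]; nlinarith
  · refine mem_closure_ktri hδ ?_ ?_ ?_ ?_
    · rw [meshPoint_re, xR_zero]; push_cast; exact hδk
    · rw [meshPoint_re, xR_zero]; push_cast; exact le_rfl
    · rw [sideFn_xR]
    · rw [sideFn_succ_xR]; nlinarith
  · refine mem_closure_ktri hδ ?_ ?_ ?_ ?_
    · rw [meshPoint_re, xL_zero]
    · rw [meshPoint_re, xL_zero]; exact hδk
    · rw [sideFn_xL_succ]; nlinarith
    · rw [sideFn_xL]
  · refine mem_closure_ktri hδ ?_ ?_ ?_ ?_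
    · rw [meshPoint_re, xR_zero]; push_cast; exact hδk
    · rw [meshPoint_re, xR_zero]; push_cast; exact le_rfl
    · rw [sideFn_xR_succ]; nlinarith
    · rw [sideFn_xR]

/-- A closed segment between two corners of a triangle lies in its closure. [folklore] -/
theorem segment_subset_closure_ktri {δ : ℝ} (hδ : 0 < δ) {k n : ℤ} {v w : Site 2}
    (hv : IsCorner k n v) (hw : IsCorner k n w) :
    segment ℝ (meshPoint δ v) (meshPoint δ w) ⊆ closure (ktri δ k n) :=
  (convex_ktri δ k n).closure.segment_subset (meshPoint_mem_closure_ktri hδ hv)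
    (meshPoint_mem_closure_ktri hδ hw)

/-- **Distinct corners of a triangle are `𝕋`-neighbours.** [folklore] -/
theorem triGraph_adj_of_isCorner {k n : ℤ} {v w : Site 2} (hv : IsCorner k n v) (hw : IsCorner k n w)
    (hne : v ≠ w) : triGraph.Adj v w := by
  -- all corners have coordinates `v₀ ∈ {k, k+1}`, `v₁ ∈ {⌊n/2⌋, ⌊n/2⌋ + 1}`, and `(k+1, ⌊n/2⌋+1)`,
  -- `(k, ⌊n/2⌋)` are never both corners; check the finitely many cases
  rw [triGraph_adj_iff, zdGraph_adj_iff]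
  have key : ∀ a b : Site 2, IsCorner k n a → IsCorner k n b → a ≠ b →
      ((∃ i, b = a + Pi.single i 1 ∨ a = b + Pi.single i 1) ∨ b = a + triDiag ∨ a = b + triDiag) := by
    intro a b ha hb hab
    have hcases : ∀ c : Site 2, IsCorner k n c →
        (c 0 = k ∧ c 1 = cTop n) ∨ (c 0 = k + 1 ∧ c 1 = cBot n) ∨
          (c 0 = k ∧ c 1 = cBot n + 1) ∨ (c 0 = k + 1 ∧ c 1 = cTop n) := by
      rintro c (rfl | rfl | rfl | rfl)
      · exact Or.inl ⟨rfl, rfl⟩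
      · exact Or.inr (Or.inl ⟨rfl, rfl⟩)
      · exact Or.inr (Or.inr (Or.inl ⟨rfl, xL_succ_one k n⟩))
      · exact Or.inr (Or.inr (Or.inr ⟨rfl, xR_succ_one k n⟩))
    have hab' : ¬ (a 0 = b 0 ∧ a 1 = b 1) := fun h => hab (Mesh.site2_ext' h.1 h.2)
    have hct := cTop_eq n
    rcases emod_two_eq n with hr | hr <;> rw [hr] at hct <;>
      rcases hcases a ha with ⟨ha0, ha1⟩ | ⟨ha0, ha1⟩ | ⟨ha0, ha1⟩ | ⟨ha0, ha1⟩ <;>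
      rcases hcases b hb with ⟨hb0, hb1⟩ | ⟨hb0, hb1⟩ | ⟨hb0, hb1⟩ | ⟨hb0, hb1⟩ <;>
      first
        | exact absurd ⟨by omega, by omega⟩ hab'
        | exact Or.inl ⟨0, Or.inl (Mesh.site2_ext' (by simp; omega) (by simp; omega))⟩
        | exact Or.inl ⟨0, Or.inr (Mesh.site2_ext' (by simp; omega) (by simp; omega))⟩
        | exact Or.inl ⟨1, Or.inl (Mesh.site2_ext' (by simp; omega) (by simp; omega))⟩
        | exact Or.inl ⟨1, Or.inr (Mesh.site2_ext' (by simp; omega) (by simp; omega))⟩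
        | exact Or.inr (Or.inl (Mesh.site2_ext' (by simp [triDiag]; omega) (by simp [triDiag]; omega)))
        | exact Or.inr (Or.inr (Mesh.site2_ext' (by simp [triDiag]; omega) (by simp [triDiag]; omega)))
  exact key v w hv hw hne

end

end Literature.Probability.LatticeModels.TriMesh
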